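import Literature.AlgebraicGeometry.AbelianSchemes.AbelianSchemeOverBase
import Literature.AlgebraicGeometry.AbelianSchemes.AbelianSchemeOverField
import Literature.AlgebraicGeometry.Motives.AbelianVarietyProofs
import Literature.AlgebraicGeometry.Motives.AbelianVarietyMulN
import HarnessLib

/-!
# The fibres of an abelian scheme of relative dimension `g` have dimension `g` (base-scheme carrier)

Cell hodgecm-mathlib, M1PRIME-DAG rung 0, W3 leaf (K3-d) of B-p03 (g10)'s list (2026-08-29T01:54:13Z): the closer of the
λ-clause transport `LamClauseTransportR` needs `0 < (A.fibre s).toAbelianVariety.dim` for an abelian scheme `A → S` of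
relative dimension `g` with `0 < g`.  [GortzWedhorn2020, Remark 16.54 (p. 678)]: «a smooth morphism of relative dimension
`d` … all non-empty fibres are equidimensional of dimension `d`»; for the base-scheme carrier
`AbelianSchemeOver S` (★ D1 `AbelianSchemeOverBase`) the fibre `A.fibre s` over a field-valued point
`s : Spec Ω ⟶ S` is an abelian scheme over `Spec Ω` of relative dimension `g` (★ `IsOfRelDim.fibre`), and over a
field the relative dimension is the dimension of the abelian variety (★ `AbelianScheme.isOfRelDim_dim`); the two
numbers agree by uniqueness of the relative dimension of a smooth morphism with non-empty source
(★ `Motives.AbelianVarietyProofs.eq_of_smoothOfRelativeDimension`, the origin witnessing non-emptiness) — the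
affine-base analogue is ★ `AbelianScheme.dim_fibre_of_isOfRelDim` (`AbelianSchemeCotangentCharpolySpread.lean`).

THEOREMS ONLY (no definition, no named fact, no instance, no `sorry`); B-p19 (g9).
HC_CM is proved only modulo the 7 printed citations until rung 0 closes.

## References
* [GortzWedhorn2020] U. Görtz, T. Wedhorn, *Algebraic Geometry I* (2nd ed.), Remark 16.54 (p. 678); Def. 6.14, Prop. 6.15.
* [MumfordFogartyKirwan1994] D. Mumford, J. Fogarty, F. Kirwan, *Geometric Invariant Theory* (3rd ed.), Ch. 6 §1 Def. 6.1 (p. 115).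
-/

universe u

open CategoryTheory AlgebraicGeometry

namespace Literature.AlgebraicGeometry.AbelianSchemes

namespace AbelianSchemeOver

variable {S : Scheme.{u}} {A : AbelianSchemeOver S} {g : ℕ}

/-- **The fibres of an abelian scheme `A → S` of relative dimension `g` are abelian varieties of dimension `g`**
(relative dimension is stable under base change — ★ `IsOfRelDim.fibre` — and over a field it is the dimension —
★ `AbelianScheme.isOfRelDim_dim`; uniqueness of the relative dimension of a smooth morphism with non-empty source).
[cite: GortzWedhorn2020, Remark 16.54 (p. 678)] -/
theorem dim_fibre_of_isOfRelDim (h : A.IsOfRelDim g) {Ω : Type u} [Field Ω] (s : Spec (.of Ω) ⟶ S) :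
    (A.fibre s).toAbelianVariety.dim = g := by
  have h₁ : SmoothOfRelativeDimension g (A.fibre s).X.hom := h.fibre s
  have h₂ : SmoothOfRelativeDimension (A.fibre s).toAbelianVariety.dim (A.fibre s).X.hom :=
    (A.fibre s).isOfRelDim_dim
  haveI : Nonempty (A.fibre s).X.left := ⟨Motives.AbelianVariety.origin (A.fibre s).toAbelianVariety⟩
  exact Motives.AbelianVarietyProofs.eq_of_smoothOfRelativeDimension _ h₂ h₁

/-- **Positive relative dimension ⇒ positive-dimensional fibres** — the (K3-d) form consumed by the λ-clause
transport of the W3 assembly: `0 < g → A.IsOfRelDim g → 0 < (A.fibre s).toAbelianVariety.dim`.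
[cite: GortzWedhorn2020, Remark 16.54 (p. 678)] -/
theorem dim_fibre_pos_of_isOfRelDim (hg : 0 < g) (h : A.IsOfRelDim g) {Ω : Type u} [Field Ω]
    (s : Spec (.of Ω) ⟶ S) : 0 < (A.fibre s).toAbelianVariety.dim := by
  rw [dim_fibre_of_isOfRelDim h s]
  exact hg

end AbelianSchemeOver

end Literature.AlgebraicGeometry.AbelianSchemes
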